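import Mathlib
import Summits.Ventures.PercRepro.TriangleCapZoneTools

/-!
# PercRepro — THE UNIFORM COST OF PARTIAL VALUES: `P (D − 1) + φ_{D−2}(S − P)` (p3, gen 56; part 331)

`P` values `1 ≤ c_i ≤ D − 1` with sum `S` cost `Σ c_i (D − c_i) ≥ P (D − 1) + φ_{D−2}(S − P)`
(`sum_partial_ge_card_add_phi`): termwise `c (D − c) = (D − 1) + (c − 1)(D − 2 − (c − 1))`, and the shifted values
`c_i − 1 ≤ D − 2` obey the residue bound of part 301 at the modulus `D − 2`.  This is the row bound the narrow regime
one below the threshold needs in its branch «`P ≥ j + 2` partial rows with sum `(j + 1) D − d`» (§10ds(i),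
mining/narrow_scan.py: 243,530 cases, 0 violations); at `P = 2`, `S ≤ D` it is `sum_partial_ge_phi_add` of part 328
and at `P = 3`, `S = 2 D − d` it is `2 (D − 1) + (D − d) d`.  Axioms: standard.
-/

namespace PercRepro

namespace TriangleCap

namespace C047

open Finset

/-- The termwise identity: `c (D − c) = (D − 1) + (c − 1) (D − 2 − (c − 1))` for `1 ≤ c ≤ D − 1`. -/
theorem partial_cost_eq (D c : ℕ) (h1 : 1 ≤ c) (h2 : c + 1 ≤ D) :
    c * (D - c) = (D - 1) + (c - 1) * (D - 2 - (c - 1)) := by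
  obtain ⟨a, rfl⟩ : ∃ a, c = a + 1 := ⟨c - 1, by omega⟩
  obtain ⟨e, rfl⟩ : ∃ e, D = a + 1 + (e + 1) := ⟨D - a - 2, by omega⟩
  have e1 : a + 1 + (e + 1) - (a + 1) = e + 1 := by omega
  have e2 : a + 1 + (e + 1) - 1 = a + e + 1 := by omega
  have e3 : a + 1 - 1 = a := by omega
  have e4 : a + 1 + (e + 1) - 2 - a = e := by omega
  rw [e1, e2, e3, e4]
  ring

/-- **THE UNIFORM COST OF PARTIAL VALUES:** values `1 ≤ c_i ≤ D − 1` on `s` cost at least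
`|s| (D − 1) + φ_{D−2}(Σ c_i − |s|)`. -/
theorem sum_partial_ge_card_add_phi {ι : Type*} (s : Finset ι) (c : ι → ℕ) (D : ℕ)
    (hc1 : ∀ i ∈ s, 1 ≤ c i) (hcD : ∀ i ∈ s, c i + 1 ≤ D) :
    s.card * (D - 1) + phiD (D - 2) (∑ i ∈ s, c i - s.card) ≤ ∑ i ∈ s, c i * (D - c i) := by
  have hterm : ∑ i ∈ s, c i * (D - c i) = ∑ i ∈ s, ((D - 1) + (c i - 1) * (D - 2 - (c i - 1))) :=
    sum_congr rfl (fun i hi => partial_cost_eq D (c i) (hc1 i hi) (hcD i hi))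
  rw [hterm, sum_add_distrib, sum_const, smul_eq_mul]
  have hshift : ∑ i ∈ s, (c i - 1) + s.card = ∑ i ∈ s, c i := by
    rw [card_eq_sum_ones, ← sum_add_distrib]
    apply sum_congr rfl
    intro i hi
    have := hc1 i hi
    omega
  have hsub : ∑ i ∈ s, c i - s.card = ∑ i ∈ s, (c i - 1) := by omega
  rw [hsub]
  have := sum_mul_sub_ge_phi s (fun i => c i - 1) (D - 2) (fun i hi => by have := hcD i hi; omega)
  omega

end C047

end TriangleCap

end PercRepro
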